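import Literature.NumberTheory.GelbartRogawski1991.LocalDoubledUnitarySplittingDataCM
import Literature.NumberTheory.GelbartRogawski1991.QuadExtSplittingCharLocalComponents
import Literature.NumberTheory.GelbartRogawski1991.CMSplittingCharLocalComponents
import HarnessLib

/-!
# The non-archimedean local package of [GelbartRogawski1991, Prop. 3.1.1] behind `hGRU` — module III′: the LOCAL DATUM,
# its parabolic normalisation and unramified clause for a global splitting character of an ARBITRARY quadratic `E/F`

Topic `NumberTheory/GelbartRogawski1991`; namespace
`Literature.NumberTheory.GelbartRogawski1991.UnitaryDualPair.LocalSplitting.QuadExt`.  One definition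
(`localSplittingDatumQuadExt`, a choice-free case split packaging the tree's non-split ∕ split data) and theorems;
no named fact, no `sorry`.

This is the general-`(F, E, c, δ)` form of `LocalDoubledUnitarySplittingDataCM.lean` §CM.  Modules I
(`LocalDoubledUnitarySplittingData`: the non-split datum `localSplittingDatumNonsplit`, Kudla's big-cell splitting,
`L8_parabolicNormalised`), II (`…Split`: the split datum `localSplittingDatumSplit`, `L8s_parabolicNormalised`) and the
unramified clauses `L7_unramified` ∕ `L7s_unramified` (module III §Unramified) are ALREADY stated for an arbitrary
quadratic extension `E/F` of number fields with an `F`-automorphism `c` and `δ ∈ E`, `c δ = -δ ≠ 0`, `δ² = d ∈ F`;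
the only CM-bound step of the GR-1 package was the instantiation of the local character family
`χv w := (χ.localComponent w)⁻¹` at a GLOBAL splitting character `χ` of the CM field (`IsSplittingChar L 1 χ`).  Here
`χ` is a Hecke character of `E` with `χ|_{𝕀_F} = ε_{E/F}` — `IsSplittingCharExt F E 1 χ`
(`HarrisKudlaSweet1996/GlobalSplittingCharactersQuadExt.lean`; such `χ` EXIST for every quadratic `E/F`,
`exists_isUnitary_isSplittingCharExt_one`) — and the four local hypotheses come from
`QuadExtSplittingCharLocalComponents.lean`:

* `isTrivialNearOne_localComponent_inv`, `isEpsilonChar_localComponent_inv` (non-split `w`: `χ_w⁻¹|_{F_vˣ} = (d, ·)_v`),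
  `isSplitPair_localComponent_inv` (split `w`), `eventually_isGoodPlace_localComponent_inv` (the good places are cofinite);
* **`localSplittingDatumQuadExt`** — THE LOCAL DATUM AT `v`: the split datum at a split place (some `w ∣ v` with
  `c • w ≠ w`), the non-split datum otherwise;
* **`localSplittingDatumQuadExt_parabolic`** — the parabolic normalisation (L8 ∕ L8s by cases):
  `(r(δ') ω_v(p) r(δ')⁻¹ Φ)(0) = (∏_w χ_w⁻¹(det_Δ p_w))⁻¹ · ∏_w ‖det_Δ p_w‖_w^{1/2} · Φ(0)` on `P_Δ(F_v)`
  ([Kudla1994, Thm 3.1]; [HarrisKudlaSweet1996, §1 (1.16)]);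
* **`localSplittingDatumQuadExt_unramified`** — the unramified clause at a good place (L7 ∕ L7s by cases):
  `ω_v(k) 1_𝒪 = 1_𝒪` for `k ∈ H(𝒪_v)` ([GelbartRogawski1991, §3.1 (3.1.3) p. 456]);
* **`localSplittingDatumCM_eq`** — the CM datum of module III IS this datum at
  `(F, E, c, δ, d) := (L⁺, L, complexConj, imagUnit L, imagUnitSq L)` (definitional).

These are the three inputs of the finite half of the doubling construction (GR-2's `nonempty_finLocalFamily` ∕
`DoubledWeilRepresentationFiniteHalf`) at general `(F, E, c)`.  Written for the general-`(F, E, σ)` programme of the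
kernel proof of [GelbartRogawski1991, Prop. 3.1.1] (`Prop311AsPrinted`; seat GR-1 of the Hodge-CM cell).  Nothing in
this file is a claim of the manuscripts adjudicated by that cell.

## References

* S. S. Kudla, *Splitting metaplectic covers of dual reductive pairs*, Israel J. Math. 87 (1994), §3 Thm 3.1 [Kudla1994].
* M. Harris, S. S. Kudla, W. J. Sweet, *Theta dichotomy for unitary groups*, JAMS 9 (1996), §1 (1.5), (1.15), (1.16)
  [HarrisKudlaSweet1996].
* S. Gelbart, J. Rogawski, *L-functions and Fourier–Jacobi coefficients for the unitary group U(3)*, Invent. Math. 105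
  (1991), §3.1 Prop. 3.1.1, (3.1.3) p. 456 [GelbartRogawski1991].
-/

set_option autoImplicit false

noncomputable section

open NumberField IsDedekindDomain MeasureTheory Matrix
open Literature.RepresentationTheory.HeisenbergGroup
open Literature.NumberTheory.Automorphic Literature.NumberTheory.Automorphic.UnitaryGroup Literature.NumberTheory.Weil1964
open Literature.NumberTheory.GaloisRepresentations.IsNonarchimedeanLocalField
open Literature.GroupTheory Literature.LinearAlgebra.QuadraticForm
open Literature.NumberTheory.GelbartRogawski1991.AdaptedBlocks
open Literature.RepresentationTheory.HarrisKudlaSweet1996 Literature.NumberTheory.GaloisRepresentations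

namespace Literature.NumberTheory.GelbartRogawski1991.UnitaryDualPair.LocalSplitting.QuadExt

section General

variable (F : Type) [Field F] [NumberField F] (E : Type) [Field E] [NumberField E] [Algebra F E]
  [Algebra.IsQuadraticExtension F E] (c : E ≃ₐ[F] E)
  {δ : E} (hcδ : c δ = -δ) (hδ : δ ≠ 0) {d : F} (hd : δ * δ = algebraMap F E d)
  (v : HeightOneSpectrum (𝓞 F))
  [MeasurableSpace (v.adicCompletion F)] [BorelSpace (v.adicCompletion F)]
  (μ : Measure (v.adicCompletion F)) [μ.IsAddHaarMeasure]
  (n : ℕ) {T₀ : Matrix (Fin n) (Fin n) F}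

omit [NumberField F] [Algebra.IsQuadraticExtension F E] [MeasurableSpace (v.adicCompletion F)]
  [BorelSpace (v.adicCompletion F)] in
/-- `χ_w⁻¹` is trivial near `1` (every place). [cite: HarrisKudlaSweet1996, §1 (1.5), (1.15)] -/
theorem isTrivialNearOne_localComponent_inv (χ : HeckeCharacter E) (w : PlacesOver E v) :
    IsTrivialNearOne F E v w (χ.localComponent w.1)⁻¹ :=
  eventually_localComponent_inv_unit_eq_one χ w.1

omit [MeasurableSpace (v.adicCompletion F)] [BorelSpace (v.adicCompletion F)] in
include hcδ hδ hd in
/-- at a NON-SPLIT place `χ_w⁻¹|_{F_v^×}` is the quadratic character `(d, ·)_v` (`IsEpsilonChar`), `d = δ²`.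
[cite: HarrisKudlaSweet1996, §1 (1.5), (1.15)] -/
theorem isEpsilonChar_localComponent_inv (χ : HeckeCharacter E) (hχ : IsSplittingCharExt F E 1 χ)
    (w : PlacesOver E v) (hw : c • w.1 = w.1) :
    IsEpsilonChar F E v d w (χ.localComponent w.1)⁻¹ :=
  fun a => localComponent_inv_toPlace_eq_hilbertSymbol c hcδ hδ hd χ hχ w hw a

omit [MeasurableSpace (v.adicCompletion F)] [BorelSpace (v.adicCompletion F)] in
include hcδ hδ hd in
/-- at a SPLIT place the two components are tied (`IsSplitPair`). [cite: HarrisKudlaSweet1996, §1 (1.5), (1.15)] -/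
theorem isSplitPair_localComponent_inv (χ : HeckeCharacter E) (hχ : IsSplittingCharExt F E 1 χ)
    (w : PlacesOver E v) (hw : c • w.1 ≠ w.1) :
    IsSplitPair F E c v w (fun w' : PlacesOver E v => (χ.localComponent w'.1)⁻¹) :=
  fun x => localComponent_galInv_inv_eq c hcδ hδ hd χ hχ w hw x

omit [Algebra.IsQuadraticExtension F E] [MeasurableSpace (v.adicCompletion F)] [BorelSpace (v.adicCompletion F)] in
include hδ in
/-- the good places are cofinite for the family `χv w := χ_w⁻¹`. [cite: GelbartRogawski1991, §3.1 (3.1.3) p. 456] -/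
theorem eventually_isGoodPlace_localComponent_inv (hT₀d : IsUnit T₀.det) (χ : HeckeCharacter E) :
    ∀ᶠ v : HeightOneSpectrum (𝓞 F) in Filter.cofinite,
      IsGoodPlace F E δ v n T₀ (fun w : PlacesOver E v => (χ.localComponent w.1)⁻¹) :=
  eventually_isGoodPlace F E δ n T₀ hδ hT₀d
    (fun (v : HeightOneSpectrum (𝓞 F)) (w : PlacesOver E v) => (χ.localComponent w.1)⁻¹)
    (eventually_forall_placesOver_localComponent_inv_eq_one F E χ)

/-- **THE LOCAL DATUM AT `v` for a global splitting character `χ` of `E/F`**: the split datum at a split place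
(some `w ∣ v` with `c • w ≠ w`), the non-split datum otherwise. [cite: GelbartRogawski1991, §3.1 Prop. 3.1.1; Kudla1994, Thm 3.1] -/
def localSplittingDatumQuadExt (hT₀ : T₀.IsSymm) (hT₀d : IsUnit T₀.det) {JD : Matrix (Fin (n + n)) (Fin (n + n)) E}
    (hJD : JD = (gramD F n T₀).map (algebraMap F E)) (χ : HeckeCharacter E) (hχ : IsSplittingCharExt F E 1 χ) :
    LocalSplittingDatum F E c (n + n) hcδ hδ hd (gramD F n T₀) (gramD_isSymm F n hT₀) (isUnit_det_gramD F n hT₀d) hJD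
      v μ (deltaLagrangian F v n) (deltaLagrangian_orthogonal F v n T₀ hT₀d) := by
  classical
  exact if h : ∃ w : PlacesOver E v, c • w.1 ≠ w.1 then
    localSplittingDatumSplit F E c hcδ hδ hd v μ n hT₀ hT₀d hJD h.choose h.choose_spec
      (fun w' : PlacesOver E v => (χ.localComponent w'.1)⁻¹) (isTrivialNearOne_localComponent_inv F E v χ h.choose)
  else
    localSplittingDatumNonsplit F E c hcδ hδ hd v μ n hT₀ hT₀d hJD (Classical.choice (PlacesOver.nonempty E v))
      (not_not.1 ((not_exists.1 h) (Classical.choice (PlacesOver.nonempty E v))))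
      (fun w' : PlacesOver E v => (χ.localComponent w'.1)⁻¹)
      (isEpsilonChar_localComponent_inv F E c hcδ hδ hd v χ hχ (Classical.choice (PlacesOver.nonempty E v))
        (not_not.1 ((not_exists.1 h) (Classical.choice (PlacesOver.nonempty E v)))))
      (isTrivialNearOne_localComponent_inv F E v χ (Classical.choice (PlacesOver.nonempty E v)))

/-- **THE PARABOLIC NORMALISATION of the datum** (L8 ∕ L8s by cases):
`(r(δ') (ω_v(p) (r(δ')⁻¹ Φ)))(0) = (∏_w χ_w⁻¹(det_Δ p_w))⁻¹ · (∏_w ‖det_Δ p_w‖_w^{1/2}) · Φ(0)`.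
[cite: Kudla1994, Thm 3.1; HarrisKudlaSweet1996, §1 (1.16)] -/
theorem localSplittingDatumQuadExt_parabolic (hT₀ : T₀.IsSymm) (hT₀d : IsUnit T₀.det)
    {JD : Matrix (Fin (n + n)) (Fin (n + n)) E} (hJD : JD = (gramD F n T₀).map (algebraMap F E))
    (χ : HeckeCharacter E) (hχ : IsSplittingCharExt F E 1 χ)
    (δ' : LocalSp F (n + n) (gramD F n T₀) v)
    (hδ' : (deltaLagrangian F v n).map (toLin F v δ') = lagrangianY F (n + n) v)
    (p : UnitaryGroup.localPi E c (n + n) JD v) (hp : IsSiegelDelta F E c hcδ hδ hd v n hT₀ hJD p)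
    (Φ : SchwartzBruhat (Fin (n + n) → v.adicCompletion F)) :
    ((((localSplittingDatumQuadExt F E c hcδ hδ hd v μ n hT₀ hT₀d hJD χ hχ).r δ')
        ((localSplittingDatumQuadExt F E c hcδ hδ hd v μ n hT₀ hT₀d hJD χ hχ).localOmega p
          (((localSplittingDatumQuadExt F E c hcδ hδ hd v μ n hT₀ hT₀d hJD χ hχ).r δ').symm Φ)) :
        SchwartzBruhat (Fin (n + n) → v.adicCompletion F)) : (Fin (n + n) → v.adicCompletion F) → ℂ) 0 =
      (((chiDet F E c v n (fun w' : PlacesOver E v => (χ.localComponent w'.1)⁻¹) p)⁻¹ : ℂˣ) : ℂ) *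
        ((∏ w' : PlacesOver E v, Real.sqrt ‖detDelta F E c v n w' p‖ : ℝ) : ℂ) *
        ((Φ : SchwartzBruhat (Fin (n + n) → v.adicCompletion F)) : (Fin (n + n) → v.adicCompletion F) → ℂ) 0 := by
  unfold localSplittingDatumQuadExt
  split_ifs with h
  · exact L8s_parabolicNormalised F E c hcδ hδ hd v μ n hT₀ hT₀d hJD h.choose h.choose_spec _
      (isSplitPair_localComponent_inv F E c hcδ hδ hd v χ hχ h.choose h.choose_spec) _ δ' hδ' p hp Φ
  · exact L8_parabolicNormalised F E c hcδ hδ hd v μ n hT₀ hT₀d hJD _ _ _ _ _ δ' hδ' p hp Φ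

/-- **THE UNRAMIFIED CLAUSE of the datum at a good place** (L7 ∕ L7s by cases); the good places are cofinite by
`eventually_isGoodPlace_localComponent_inv`. [cite: GelbartRogawski1991, §3.1 (3.1.3) p. 456] -/
theorem localSplittingDatumQuadExt_unramified (hT₀ : T₀.IsSymm) (hT₀d : IsUnit T₀.det)
    {JD : Matrix (Fin (n + n)) (Fin (n + n)) E} (hJD : JD = (gramD F n T₀).map (algebraMap F E))
    (χ : HeckeCharacter E) (hχ : IsSplittingCharExt F E 1 χ)
    (hgood : IsGoodPlace F E δ v n T₀ (fun w' : PlacesOver E v => (χ.localComponent w'.1)⁻¹)) :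
    ∀ k ∈ UnitaryGroup.localInt E c (n + n) JD v,
      (localSplittingDatumQuadExt F E c hcδ hδ hd v μ n hT₀ hT₀d hJD χ hχ).localOmega k
          (unitVec F (Fin (n + n)) v) = unitVec F (Fin (n + n)) v := by
  unfold localSplittingDatumQuadExt
  split_ifs with h
  · exact L7s_unramified F E c hcδ hδ hd v μ n hT₀ hT₀d hJD h.choose h.choose_spec _ _ hgood
  · exact L7_unramified F E c hcδ hδ hd v μ n hT₀ hT₀d hJD _ _ _ _ _ hgood

end General

/-! ## The CM datum is the general datum at CM data -/

section CM

open Literature.RepresentationTheory.HarrisKudlaSweet1996 Literature.NumberTheory.GaloisRepresentations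

variable (L : Type) [Field L] [NumberField L] [IsCMField L]
  (v : HeightOneSpectrum (𝓞 (maximalRealSubfield L)))
  [MeasurableSpace (v.adicCompletion (maximalRealSubfield L))] [BorelSpace (v.adicCompletion (maximalRealSubfield L))]
  (μ : Measure (v.adicCompletion (maximalRealSubfield L))) [μ.IsAddHaarMeasure]
  (n : ℕ) {T₀ : Matrix (Fin n) (Fin n) (maximalRealSubfield L)}

/-- **the CM datum `localSplittingDatumCM` of module III IS `localSplittingDatumQuadExt` at
`(F, E, c, δ, d) := (L⁺, L, complexConj, imagUnit L, imagUnitSq L)`** (the CM splitting condition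
`IsSplittingChar L 1 χ` being `IsSplittingCharExt L⁺ L 1 χ`, `isSplittingChar_iff_isSplittingCharExt`); definitional.
[cite: GelbartRogawski1991, §3.1 Prop. 3.1.1; Kudla1994, Thm 3.1] -/
theorem localSplittingDatumCM_eq (hT₀ : T₀.IsSymm) (hT₀d : IsUnit T₀.det)
    {JD : Matrix (Fin (n + n)) (Fin (n + n)) L}
    (hJD : JD = (gramD (maximalRealSubfield L) n T₀).map (algebraMap (maximalRealSubfield L) L))
    (χ : HeckeCharacter L) (hχ : IsSplittingChar L 1 χ) :
    localSplittingDatumCM L v μ n hT₀ hT₀d hJD χ hχ =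
      localSplittingDatumQuadExt (maximalRealSubfield L) L (IsCMField.complexConj L) (complexConj_imagUnit L)
        (imagUnit_ne_zero L) (imagUnit_mul_self L) v μ n hT₀ hT₀d hJD χ
        ((isSplittingChar_iff_isSplittingCharExt L 1 χ).1 hχ) :=
  rfl

end CM

end Literature.NumberTheory.GelbartRogawski1991.UnitaryDualPair.LocalSplitting.QuadExt

end
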